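import Summits.ResolutionOfSingularities.ResolutionOfSingularities.Theorems.WeightedInvariantIota3TauDescentCaseB
import HarnessLib

/-!
# (desc-τ) IN THE DOOR SETTING ⟸ (ADAPT): the descent of tie positions for bases essentially of finite type over a field, reduced to the existence
# of an rsp-adapted Abramovich–Quek–Schober datum downstairs (door `HypersurfaceCentreConstruction`, stmt-ResolutionOfSingularities-19897; gap (1) (desc-τ))

Topic: `Summits/ResolutionOfSingularities/ResolutionOfSingularities/Theorems`. Helper for the door item `HypersurfaceCentreConstruction`
(stmt-ResolutionOfSingularities-19897, route `WeightedInvariant`), line `local-engine`, def-free.  Audit glue over this hand's files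
(…Iota3TauDescentLowDim, …BaseTwo…, …ExtReesBaseChange, …CaseB): for a base `T` regular local and essentially of finite type over a field `k₀`,

  **`Iota3.isTiePosition_descent_door_of_adapt`**: (desc-τ) `∀ φ : T → T'` (local, formally smooth, essentially of finite type, `T'` regular local,
  `dim T' ≤ 3`): `IsTiePosition T' (φ g) → IsTiePosition T g` — GIVEN ONLY (ADAPT): «whenever `dim T = dim T' = 3`, `𝔪_T T' = 𝔪'` and `(T', φ g)` is a tie
  position, `(T, g)` carries an rsp-adapted lex-maximal datum `(x, y, z; w; ℓ)`» (`Iota3.isTiePosition_of_adapted_datum`'s hypothesis).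

Cases: `dim T ≤ 1` (…LowDim), `dim T = 2` (`not_isTiePosition_map_of_ringKrullDim_eq_two`, …ExtReesBaseChange), `dim T = 3` (…CaseB + (ADAPT)).
(ADAPT) holds outright when the tie's weights are `(1, 1)`; in general it is the numerator question of the memo TAU-DESCENT-A.md §3–§4.

[OURS · L1 W4.3 · (desc-τ) door setting ⟸ (ADAPT)]  Replaces the role of NO printed item; NOT a statement of the manuscript under review
[claim: Hironaka2017, status: under-review]; candidates stay candidates; AI work, weaker than expert review.  No definition; no axiom; (ADAPT) is a hypothesis.
-/

noncomputable section

set_option linter.dupNamespace false -- mandated namespace `Summit.<Summit>.<Problem>` of this single-conjunct summit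

open IsLocalRing Literature.AlgebraicGeometry.Resolution
open Summit.ResolutionOfSingularities.ResolutionOfSingularities.Theorems
open Summit.ResolutionOfSingularities.ResolutionOfSingularities.Theorems.ContactCylinder

namespace Summit.ResolutionOfSingularities.ResolutionOfSingularities.Cruxes.HypersurfaceCentreConstruction.LocalEngine

namespace Iota3

/-- **(desc-τ) IN THE DOOR SETTING FROM (ADAPT).**  See the module docstring. [OURS · audit glue] [cite: AbramovichQuekSchober2025, Thm 1.3] -/
theorem isTiePosition_descent_door_of_adapt (T T' : Type) [CommRing T] [CommRing T'] [IsRegularLocalRing T] [IsRegularLocalRing T']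
    [Algebra T T'] [IsLocalHom (algebraMap T T')] [Algebra.FormallySmooth T T'] [Algebra.EssFiniteType T T']
    (k₀ : Type) [Field k₀] [Algebra k₀ T] [Algebra.EssFiniteType k₀ T] {g : T}
    (hadapt : ringKrullDim T = (3 : ℕ) → ringKrullDim T' = (3 : ℕ) → (maximalIdeal T).map (algebraMap T T') = maximalIdeal T' →
      IsTiePosition T' (algebraMap T T' g) →
      ∃ (x y z : T) (w : Fin 2 → ℕ) (ℓ : ℕ) (hP : (Ideal.span ({x, y} : Set T)).IsPrime),
        Ideal.span {x, y, z} = maximalIdeal T ∧ topStratumPrime iotaOrdEps T g = Ideal.span {x, y} ∧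
        @IsLexMaxWeightedCentreGerm (Localization.AtPrime (Ideal.span ({x, y} : Set T))) _
          (@Localization.AtPrime.isLocalRing _ _ (Ideal.span ({x, y} : Set T)) hP)
          (Ideal.span {algebraMap T (Localization.AtPrime (Ideal.span ({x, y} : Set T))) g})
          ![algebraMap T (Localization.AtPrime (Ideal.span ({x, y} : Set T))) y,
            algebraMap T (Localization.AtPrime (Ideal.span ({x, y} : Set T))) x] w ℓ)
    (_hdimT' : ringKrullDim T' ≤ 3) (ht' : IsTiePosition T' (algebraMap T T' g)) : IsTiePosition T g := by
  obtain ⟨h3', h2 | h3⟩ := ringKrullDim_eq_of_isTiePosition_map T T' ht'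
  · exact absurd ht' (not_isTiePosition_map_of_ringKrullDim_eq_two T T' k₀ h2 g)
  · have h𝔪 : (maximalIdeal T).map (algebraMap T T') = maximalIdeal T' :=
      EssSmoothLE2.map_maximalIdeal_eq_of_ringKrullDim_eq T T' (by rw [h3, h3'])
    obtain ⟨x, y, z, w, ℓ, hP, hxyz, hP₀, hlex⟩ := hadapt h3 h3' h𝔪 ht'
    haveI := hP
    exact isTiePosition_of_adapted_datum T T' h3 ht' hxyz hP₀ hlex

end Iota3

end Summit.ResolutionOfSingularities.ResolutionOfSingularities.Cruxes.HypersurfaceCentreConstruction.LocalEngine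

end
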